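import Summits.Ventures.DiscreteObjects.Hadamard.ElemAbelianRank2_23
import Summits.Ventures.DiscreteObjects.Hadamard.ElemAbelianRank2Large668
import Summits.Ventures.DiscreteObjects.Hadamard.PrimeSquareOrder

/-!
# Hadamard 668 census, family F12 — Sylow subgroups for `p ≥ 13`: no `C_p × C_p` and no `C_{p²}` (kernel summary)

Framing: lottery ticket; floor = certified bounds/negative ranges.

Cell pub-namedobj (venture DiscreteObjects), target (H), hadamard gen 16.  ONE QUOTABLE STATEMENT for STATEMENT.md:
**`no_hadamard668_elemAbelian_rank2`** — for every prime `p ≥ 13`, a Hadamard matrix of order `668` has no two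
signed-permutation automorphisms `(α, α', d₁, e₁)`, `(β, β', d₂, e₂)` with `α^p = β^p = α'^p = β'^p = 1`, commuting
permutation parts, and `α, β` independent (`α^a β^b = 1`, `a, b < p` ⇒ `a = b = 0`): the cases `p ∉ {13,23,37,41,83,167}`
have no element of order `p` at all (`hadamard668_signedAut_prime_mem'`), `p ∈ {13,37,41,83,167}` are
`no_hadamard668_elemAbelian_rank2_large` (Burnside), `p = 23` is `no_hadamard668_elemAbelian_rank2_23` (orthogonality).
Together with `hadamard668_signedAut_not_dvd_orderOf_sq` (PrimeSquareOrder: `p² ∤ orderOf (π, κ)` for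
`p ∈ {11,13,23,37,41,83,167}`), and since a group of order `p²` is cyclic or `C_p × C_p`: **for every prime `p ≥ 13`
the Sylow `p`-subgroups of the signed automorphism group of any H(668) are trivial or of order `p`; the part of
`|Aut H(668)|` coprime to `2·3·5·7·11` is squarefree, dividing `13·23·37·41·83·167`.** (p = 11: `C₁₁ × C₁₁` is excluded
at the summed orbit level by two exact implementations, FAMILY-F12-G16 §2(c), not in the kernel; p ∈ {3,5,7}: open.)
Ours, not literature; no `sorry`.
-/

namespace Summit.Ventures.DiscreteObjects.Hadamard

open Finset BigOperators

open Literature.Combinatorics.Designs.GoethalsSeidel (IsHadamardMatrix)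

variable {ι : Type*} [Fintype ι] [DecidableEq ι]

/-- **No rank-2 elementary abelian `p`-subgroup `C_p × C_p` of signed automorphisms of an H(668), for any prime
`p ≥ 13`.** -/
theorem no_hadamard668_elemAbelian_rank2 {H : Matrix ι ι ℤ} (hH : IsHadamardMatrix H)
    (hι : Fintype.card ι = 668) (p : ℕ) (hp : p.Prime) (hp13 : 13 ≤ p)
    {α α' β β' : Equiv.Perm ι} {d₁ e₁ d₂ e₂ : ι → ℤ}
    (hA : IsSignedAut H α α' d₁ e₁) (hB : IsSignedAut H β β' d₂ e₂)
    (hα : α ^ p = 1) (hα' : α' ^ p = 1) (hβ : β ^ p = 1) (hβ' : β' ^ p = 1)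
    (hc : Commute α β) (hc' : Commute α' β')
    (hind : ∀ a b : ℕ, a < p → b < p → α ^ a * β ^ b = 1 → a = 0 ∧ b = 0) : False := by
  by_cases h23 : p = 23
  · subst h23
    exact no_hadamard668_elemAbelian_rank2_23 hH hι hA hB hα hα' hβ hβ' hc hc' hind
  · exact no_hadamard668_elemAbelian_rank2_large hH hι p hp hp13 h23 hA hB hα hα' hβ hβ' hc hc' hind

/-- **The `p`-part of the automorphism group, `p ≥ 13` (packaging).**  (1) no `C_p × C_p` as above; (2) no element
whose permutation pair has order divisible by `p²` (`hadamard668_signedAut_not_dvd_orderOf_sq`, restated for the primes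
that occur). -/
theorem hadamard668_sylow_large_summary {H : Matrix ι ι ℤ} (hH : IsHadamardMatrix H) (hι : Fintype.card ι = 668) :
    (∀ (p : ℕ), p.Prime → 13 ≤ p → ∀ {α α' β β' : Equiv.Perm ι} {d₁ e₁ d₂ e₂ : ι → ℤ},
      IsSignedAut H α α' d₁ e₁ → IsSignedAut H β β' d₂ e₂ → α ^ p = 1 → α' ^ p = 1 → β ^ p = 1 → β' ^ p = 1 →
      Commute α β → Commute α' β' → (∀ a b : ℕ, a < p → b < p → α ^ a * β ^ b = 1 → a = 0 ∧ b = 0) → False) ∧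
    (∀ (p : ℕ), (p = 11 ∨ p = 13 ∨ p = 23 ∨ p = 37 ∨ p = 41 ∨ p = 83 ∨ p = 167) →
      ∀ {π κ : Equiv.Perm ι} {d e : ι → ℤ},
      IsSignedAut H π κ d e → ¬ p * p ∣ orderOf ((π, κ) : Equiv.Perm ι × Equiv.Perm ι)) := by
  refine ⟨?_, ?_⟩
  · intro p hp hp13 α α' β β' d₁ e₁ d₂ e₂ hA hB hα hα' hβ hβ' hc hc' hind
    exact no_hadamard668_elemAbelian_rank2 hH hι p hp hp13 hA hB hα hα' hβ hβ' hc hc' hind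
  · intro p hp π κ d e haut hdvd
    exact hadamard668_signedAut_not_dvd_orderOf_sq hH hι π κ d e haut hp hdvd

end Summit.Ventures.DiscreteObjects.Hadamard
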